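import Literature.Combinatorics.SimpleGraph.HamiltonianPathCount
import Literature.Combinatorics.SimpleGraph.HamiltonianPathSegments
import HarnessLib

/-!
# Three-port vertex gadgets in Hamiltonian-path counts, I: the gadget is traversed once

Local replacement for COUNTING Hamiltonian paths (Garey–Johnson 1979, §3.2.2), the case of a
gadget attached at THREE PORTS by one edge each — the way the Tutte gadget enters the reduction of
Garey–Johnson–Tarjan 1976 and of Liśkiewicz–Ogihara–Toda 2003, §3 (eight copies per XOR-gadget,
Fig. 2 (a): "To visit `c` without missing a node, one has to either enter from `a` and visit `b`
on its way or enter from `b` and visit `a` on its way"). The edge-slot substitution of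
`HamiltonianGadgetSubstitution.lean` needs slots with pairwise disjoint ends, which a three-port
vertex gadget does not provide; this file and its sequel `HamiltonianPortGadgetCount.lean` give
the vertex version: the gadget `VT` hangs on the ports `x, y, z ∈ V` of the host by the three
port edges `x – a`, `y – b`, `z – c`, and the counting identity compares the big graph `G'` on
`V ∪ VT` with the BASE GRAPH `M` on `V ∪ {τ}` in which the gadget is a single fresh vertex `τ`
joined to `x, y, z`:

  `#Ham(G', R, F) = Σ_{{u,v} ⊆ {x,y,z}} #Ham_{G'[VT]}(nb u → nb v) · #Ham(M, R ∪ {uτ, τv}, F)`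

(`nb` = the gadget neighbour of a port; for the Tutte gadget the three censuses are `4, 2, 0`,
`TutteFragment.lean`). This file proves the structural half:

* `PortGadget G' V VT x y z a b c M τ` — the hypotheses (fresh gadget vertices, three distinct
  ports, the cross edges are exactly the port edges, `M` = `G'` on `V` plus the star of `τ`);
* `PortGadget.nb`, `adj_cross_iff` — a cross edge is a port edge;
* **`PortGadget.seg_covers`** — in a Hamiltonian `s`–`t` path of `G'` (`s, t ∈ V`) every segment
  inside `VT` (`IsSeg`, `HamiltonianPathSegments.lean`) contains ALL of `VT`: the gadget is
  traversed exactly once (two traversals would use four of the three port edges);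
  `seg_unique`, `exists_seg`;
* **`PortGadget.decomp`** — hence `l' = l₁ ++ u :: (xs ++ v :: l₂)` with `u ≠ v` ports, `xs` a
  Hamiltonian path of `G'` through `VT` from `nb u` to `nb v`, and `l₁, l₂` inside `V`;
* `pair_infix_append_iff` and friends — where a two-element infix of a concatenation sits.

## References

* M. R. Garey, D. S. Johnson, *Computers and Intractability*, Freeman 1979, §3.2.2.
* M. R. Garey, D. S. Johnson, R. E. Tarjan, SIAM J. Comput. 5 (1976) 704–714 (Tutte gadget).
* M. Liśkiewicz, M. Ogihara, S. Toda, TCS 304 (2003) 129–156, §3, Figs. 1–2.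
-/

namespace Literature.Combinatorics.SimpleGraph

variable {α : Type*} [DecidableEq α]

/-! ### Two-element infixes of concatenations -/

omit [DecidableEq α] in
/-- Where a pair sits in a concatenation: inside the first part, inside the second, or across the
seam. [folklore] -/
theorem pair_infix_append_iff {p q : α} {A B : List α} :
    [p, q] <:+: A ++ B ↔ [p, q] <:+: A ∨ [p, q] <:+: B ∨ (A.getLast? = some p ∧ B.head? = some q) := by
  rw [List.infix_append_iff_ne_nil]
  refine or_congr_right (or_congr_right ?_)
  constructor
  · rintro ⟨l₁, l₂, h₁, h₂, hl, hs, hp⟩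
    obtain ⟨a, l₁, rfl⟩ := List.exists_cons_of_ne_nil h₁
    simp only [List.cons_append, List.cons.injEq] at hl
    obtain ⟨rfl, hl⟩ := hl
    rcases l₁ with _ | ⟨d, l₁⟩
    · simp only [List.nil_append] at hl
      subst hl
      exact ⟨List.singleton_suffix_iff_getLast?_eq_some.1 hs,
        List.singleton_prefix_iff_head?_eq_some.1 hp⟩
    · simp only [List.cons_append, List.cons.injEq] at hl
      obtain ⟨rfl, hl⟩ := hl
      exact absurd (List.append_eq_nil_iff.1 hl.symm).2 h₂
  · rintro ⟨hA, hB⟩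
    exact ⟨[p], [q], List.cons_ne_nil _ _, List.cons_ne_nil _ _, rfl,
      List.singleton_suffix_iff_getLast?_eq_some.2 hA, List.singleton_prefix_iff_head?_eq_some.2 hB⟩

omit [DecidableEq α] in
/-- A pair inside `a :: l`: it is `a` and the head of `l`, or inside `l`. [folklore] -/
theorem pair_infix_cons_iff {p q a : α} {l : List α} :
    [p, q] <:+: a :: l ↔ (p = a ∧ l.head? = some q) ∨ [p, q] <:+: l := by
  have hal : a :: l = [a] ++ l := rfl
  rw [hal, pair_infix_append_iff]
  simp only [List.getLast?_singleton, Option.some.injEq]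
  constructor
  · rintro (h | h | ⟨h₁, h₂⟩)
    · have := h.length_le; simp at this
    · exact Or.inr h
    · exact Or.inl ⟨h₁.symm, h₂⟩
  · rintro (⟨rfl, h⟩ | h)
    · exact Or.inr (Or.inr ⟨rfl, h⟩)
    · exact Or.inr (Or.inl h)

omit [DecidableEq α] in
/-- A pair that is an infix has both entries in the list. [folklore] -/
theorem mem_of_pair_infix {p q : α} {l : List α} (h : [p, q] <:+: l) : p ∈ l ∧ q ∈ l :=
  ⟨h.subset (by simp), h.subset (by simp)⟩

omit [DecidableEq α] in
/-- A pair inside a concatenation whose entries avoid the middle block sits in an outer block or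
on an outer seam: if no entry of `mid ≠ []` is allowed, `[p, q] <:+: A ++ mid ++ B` iff
`[p, q] <:+: A` or `[p, q] <:+: B`. [folklore] -/
theorem pair_infix_middle_iff {p q : α} {A mid B : List α} (hmid : mid ≠ [])
    (hp : p ∉ mid) (hq : q ∉ mid) :
    [p, q] <:+: A ++ mid ++ B ↔ [p, q] <:+: A ∨ [p, q] <:+: B := by
  obtain ⟨m, mid', rfl⟩ := List.exists_cons_of_ne_nil hmid
  rw [List.append_assoc, pair_infix_append_iff, pair_infix_append_iff]
  have hq' : (m :: mid' ++ B).head? ≠ some q := by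
    simp only [List.cons_append, List.head?_cons, ne_eq, Option.some.injEq]
    rintro rfl; exact hq List.mem_cons_self
  have hp' : ¬ ((m :: mid').getLast? = some p) := fun h => hp (List.mem_of_getLast? h)
  have hnot : ¬ [p, q] <:+: m :: mid' := fun h => hp (mem_of_pair_infix h).1
  constructor
  · rintro (h | (h | h | ⟨h₁, -⟩) | ⟨-, h₂⟩)
    · exact Or.inl h
    · exact absurd h hnot
    · exact Or.inr h
    · exact absurd h₁ hp'
    · exact absurd h₂ hq'
  · rintro (h | h)
    · exact Or.inl h
    · exact Or.inr (Or.inl (Or.inr (Or.inl h)))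

/-! ### Three-port gadgets -/

/-- **A three-port vertex gadget.** The host vertices `V` and the gadget vertices `VT` are
disjoint; the ports `x, y, z ∈ V` are distinct; `a, b, c ∈ VT`; between `V` and `VT` the graph
`G'` has exactly the three port edges `x a`, `y b`, `z c`; the base graph `M` agrees with `G'` on
`V` and joins the fresh vertex `τ ∉ V` to exactly `x, y, z` among `V`.
[cite: GareyJohnson1979, §3.2.2 (local replacement)] -/
structure PortGadget (G' : _root_.SimpleGraph α) (V VT : Finset α) (x y z a b c : α)
    (M : _root_.SimpleGraph α) (τ : α) : Prop where
  /-- gadget vertices are fresh -/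
  disjoint : Disjoint V VT
  /-- ports are host vertices -/
  x_mem : x ∈ V
  /-- ports are host vertices -/
  y_mem : y ∈ V
  /-- ports are host vertices -/
  z_mem : z ∈ V
  /-- port terminals are gadget vertices -/
  a_mem : a ∈ VT
  /-- distinct ports -/
  x_ne_y : x ≠ y
  /-- distinct ports -/
  x_ne_z : x ≠ z
  /-- distinct ports -/
  y_ne_z : y ≠ z
  /-- the cross edges are exactly the port edges -/
  cross : ∀ v ∈ V, ∀ w ∈ VT, G'.Adj v w ↔ (v = x ∧ w = a) ∨ (v = y ∧ w = b) ∨ (v = z ∧ w = c)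
  /-- `τ` is fresh -/
  τ_not_mem : τ ∉ V
  /-- `M` is `G'` on the host -/
  base : ∀ v ∈ V, ∀ w ∈ V, (M.Adj v w ↔ G'.Adj v w)
  /-- `τ` is joined exactly to the ports -/
  star : ∀ v ∈ V, (M.Adj τ v ↔ v = x ∨ v = y ∨ v = z)

namespace PortGadget

variable {G' M : _root_.SimpleGraph α} {V VT : Finset α} {x y z a b c τ : α}
  (h : PortGadget G' V VT x y z a b c M τ)
include h

/-- **The gadget neighbour of a port** (`a` for `x`, `b` for `y`, `c` for `z`).
[cite: GareyJohnson1979, §3.2.2] -/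
def nb (_ : PortGadget G' V VT x y z a b c M τ) (v : α) : α :=
  if v = x then a else if v = y then b else c

/-- `nb x = a`. [folklore] -/
@[simp] theorem nb_x : h.nb x = a := by simp [nb]

/-- `nb y = b`. [folklore] -/
@[simp] theorem nb_y : h.nb y = b := by simp [nb, h.x_ne_y.symm]

/-- `nb z = c`. [folklore] -/
@[simp] theorem nb_z : h.nb z = c := by simp [nb, h.x_ne_z.symm, h.y_ne_z.symm]

omit [DecidableEq α] in
/-- Host vertices are not gadget vertices. [folklore] -/
theorem not_mem_VT {v : α} (hv : v ∈ V) : v ∉ VT :=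
  Finset.disjoint_left.1 h.disjoint hv

omit [DecidableEq α] in
/-- Gadget vertices are not host vertices. [folklore] -/
theorem not_mem_V {w : α} (hw : w ∈ VT) : w ∉ V :=
  Finset.disjoint_right.1 h.disjoint hw

/-- `v` is one of the three ports. [cite: GareyJohnson1979, §3.2.2] -/
def IsPort (_ : PortGadget G' V VT x y z a b c M τ) (v : α) : Prop :=
  v = x ∨ v = y ∨ v = z

/-- **A cross edge is a port edge**: if `v ∈ V` and `w ∈ VT` are adjacent then `v` is a port and
`w` its gadget neighbour. [cite: GareyJohnson1979, §3.2.2] -/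
theorem adj_cross_iff {v w : α} (hv : v ∈ V) (hw : w ∈ VT) :
    G'.Adj v w ↔ h.IsPort v ∧ w = h.nb v := by
  rw [h.cross v hv w hw]
  unfold IsPort
  constructor
  · rintro (⟨rfl, rfl⟩ | ⟨rfl, rfl⟩ | ⟨rfl, rfl⟩)
    · exact ⟨Or.inl rfl, h.nb_x.symm⟩
    · exact ⟨Or.inr (Or.inl rfl), h.nb_y.symm⟩
    · exact ⟨Or.inr (Or.inr rfl), h.nb_z.symm⟩
  · rintro ⟨hp, rfl⟩
    rcases hp with rfl | rfl | rfl
    · exact Or.inl ⟨rfl, h.nb_x⟩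
    · exact Or.inr (Or.inl ⟨rfl, h.nb_y⟩)
    · exact Or.inr (Or.inr ⟨rfl, h.nb_z⟩)

omit [DecidableEq α] in
/-- Ports are host vertices. [folklore] -/
theorem IsPort.mem {v : α} (hv : h.IsPort v) : v ∈ V := by
  rcases hv with rfl | rfl | rfl
  exacts [h.x_mem, h.y_mem, h.z_mem]

omit [DecidableEq α] in
/-- `τ` is adjacent in `M` to the ports. [folklore] -/
theorem adj_τ {v : α} (hv : h.IsPort v) : M.Adj τ v :=
  (h.star v hv.mem).2 hv

omit [DecidableEq α] in
/-- Four ports cannot be pairwise distinct (there are three). [folklore] -/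
theorem not_four_ports {p₁ p₂ p₃ p₄ : α} (h₁ : h.IsPort p₁) (h₂ : h.IsPort p₂) (h₃ : h.IsPort p₃)
    (h₄ : h.IsPort p₄) (h₁₂ : p₁ ≠ p₂) (h₁₃ : p₁ ≠ p₃) (h₁₄ : p₁ ≠ p₄) (h₂₃ : p₂ ≠ p₃)
    (h₂₄ : p₂ ≠ p₄) (h₃₄ : p₃ ≠ p₄) : False := by
  unfold IsPort at h₁ h₂ h₃ h₄
  rcases h₁ with rfl | rfl | rfl <;> rcases h₂ with rfl | rfl | rfl <;>
    rcases h₃ with rfl | rfl | rfl <;> rcases h₄ with rfl | rfl | rfl <;>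
    simp_all

/-! ### Segments of a Hamiltonian path of `G'` inside the gadget -/

variable {s t : α} {l' : List α}

/-- The ends of a segment inside `VT` are ports, entered and left through their port edges: the
first gadget vertex is the gadget neighbour of the entry port, the last that of the exit port.
[cite: GareyJohnson1979, §3.2.2] -/
theorem ports_of_isSeg (hl : IsHamPathOn G' (V ∪ VT) s t l') {u v : α} {xs : List α}
    (hs : IsSeg VT l' u xs v) :
    h.IsPort u ∧ h.IsPort v ∧ xs.head? = some (h.nb u) ∧ xs.getLast? = some (h.nb v) := by
  obtain ⟨_, hne, hxs, huT, hvT⟩ := id hs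
  have huV : u ∈ V := by
    have := hl.mem_iff.1 hs.mem.1
    rcases Finset.mem_union.1 this with h' | h'
    exacts [h', absurd h' huT]
  have hvV : v ∈ V := by
    have := hl.mem_iff.1 hs.mem.2.1
    rcases Finset.mem_union.1 this with h' | h'
    exacts [h', absurd h' hvT]
  have hc : List.IsChain G'.Adj (u :: (xs ++ [v])) := hl.2.2.2.2.infix hs.isInfix
  obtain ⟨w, ws, rfl⟩ := List.exists_cons_of_ne_nil hne
  have huw : G'.Adj u w := (List.isChain_cons_cons.1 hc).1
  obtain ⟨hpu, hw⟩ := (h.adj_cross_iff huV (hxs w List.mem_cons_self)).1 huw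
  have hlast : G'.Adj ((w :: ws).getLast (List.cons_ne_nil w ws)) v := by
    rw [← List.cons_append, List.isChain_append] at hc
    refine hc.2.2 _ ?_ v rfl
    rw [List.getLast?_eq_some_getLast (List.cons_ne_nil u (w :: ws)), List.getLast_cons (List.cons_ne_nil w ws)]
    rfl
  obtain ⟨hpv, hw'⟩ := (h.adj_cross_iff hvV (hxs _ (List.getLast_mem _))).1 hlast.symm
  refine ⟨hpu, hpv, by rw [List.head?_cons, hw], ?_⟩
  rw [List.getLast?_eq_some_getLast (List.cons_ne_nil w ws), hw']

omit h in
/-- The entry port differs from the exit port. [folklore] -/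
theorem ne_of_isSeg (hl : IsHamPathOn G' (V ∪ VT) s t l') {u v : α} {xs : List α}
    (hs : IsSeg VT l' u xs v) : u ≠ v := by
  intro huv
  subst huv
  have hnd := hs.nodup_piece hl.1
  rw [List.nodup_cons] at hnd
  exact hnd.1 (List.mem_append_right xs List.mem_cons_self)

/-- **The gadget is traversed once**: a segment of a Hamiltonian `s`–`t` path of `G'`
(`s, t ∈ V`) inside `VT` contains every gadget vertex — a second traversal would need a fourth
port edge. [cite: LiskiewiczOgiharaToda2003, §3 (Tutte gadget: "To visit c without missing a node, one has to either enter from a … or enter from b")] -/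
theorem seg_covers (hsV : s ∈ V) (htV : t ∈ V) (hl : IsHamPathOn G' (V ∪ VT) s t l')
    {u v : α} {xs : List α} (hs : IsSeg VT l' u xs v) : ∀ w ∈ VT, w ∈ xs := by
  intro w hwT
  by_contra hw
  have hhead : ∀ d ∈ l'.head?, d ∉ VT := fun d hd => by
    rw [hl.2.2.1] at hd
    simp only [Option.mem_def, Option.some.injEq] at hd
    subst hd
    exact h.not_mem_VT hsV
  have hlast : ∀ d ∈ l'.getLast?, d ∉ VT := fun d hd => by
    rw [hl.2.2.2.1] at hd
    simp only [Option.mem_def, Option.some.injEq] at hd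
    subst hd
    exact h.not_mem_VT htV
  obtain ⟨u', ys, v', hs', hwys⟩ :=
    exists_isSeg_of_mem (hl.mem_iff.2 (Finset.mem_union_right _ hwT)) hwT hhead hlast
  -- the two segments are disjoint
  have hdis : ∀ d, d ∈ xs → d ∈ ys → False := fun d hd hd' => by
    obtain ⟨-, rfl, -⟩ := hs.eq_of_mem_mem hl.1 hs' hd hd'
    exact hw hwys
  -- their four ports are pairwise distinct ports
  obtain ⟨hpu, hpv, hhu, hlv⟩ := h.ports_of_isSeg hl hs
  obtain ⟨hpu', hpv', hhu', hlv'⟩ := h.ports_of_isSeg hl hs'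
  have m1 : h.nb u ∈ xs := List.mem_of_mem_head? hhu
  have m2 : h.nb v ∈ xs := List.mem_of_getLast? hlv
  have m3 : h.nb u' ∈ ys := List.mem_of_mem_head? hhu'
  have m4 : h.nb v' ∈ ys := List.mem_of_getLast? hlv'
  exact h.not_four_ports hpu hpv hpu' hpv' (ne_of_isSeg hl hs)
    (fun he => hdis _ m1 (he ▸ m3)) (fun he => hdis _ m1 (he ▸ m4))
    (fun he => hdis _ m2 (he ▸ m3)) (fun he => hdis _ m2 (he ▸ m4)) (ne_of_isSeg hl hs')

/-- The segment is a Hamiltonian path of `G'` through `VT` between the gadget neighbours of its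
ports. [cite: GareyJohnson1979, §3.2.2] -/
theorem isHamPathOn_of_isSeg (hsV : s ∈ V) (htV : t ∈ V) (hl : IsHamPathOn G' (V ∪ VT) s t l')
    {u v : α} {xs : List α} (hs : IsSeg VT l' u xs v) :
    IsHamPathOn G' VT (h.nb u) (h.nb v) xs := by
  obtain ⟨-, -, hhu, hlv⟩ := h.ports_of_isSeg hl hs
  have hnd : xs.Nodup :=
    ((List.nodup_cons.1 (hs.nodup_piece hl.1)).2).of_append_left
  refine ⟨hnd, ?_, hhu, hlv, ?_⟩
  · ext w
    rw [List.mem_toFinset]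
    exact ⟨fun hw => hs.2.2.1 w hw, fun hw => h.seg_covers hsV htV hl hs w hw⟩
  · have hc : List.IsChain G'.Adj (u :: (xs ++ [v])) := hl.2.2.2.2.infix hs.isInfix
    exact hc.tail.left_of_append

/-- **All segments coincide.** [folklore] -/
theorem seg_unique (hsV : s ∈ V) (htV : t ∈ V) (hl : IsHamPathOn G' (V ∪ VT) s t l')
    {u v u' v' : α} {xs xs' : List α} (hs : IsSeg VT l' u xs v) (hs' : IsSeg VT l' u' xs' v') :
    u = u' ∧ xs = xs' ∧ v = v' :=
  hs.eq_of_mem_mem hl.1 hs' (h.seg_covers hsV htV hl hs a h.a_mem) (h.seg_covers hsV htV hl hs' a h.a_mem)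

/-- **A segment exists** (the gadget is not empty). [folklore] -/
theorem exists_seg (hsV : s ∈ V) (htV : t ∈ V) (hl : IsHamPathOn G' (V ∪ VT) s t l') :
    ∃ u xs v, IsSeg VT l' u xs v := by
  have hhead : ∀ d ∈ l'.head?, d ∉ VT := fun d hd => by
    rw [hl.2.2.1] at hd
    simp only [Option.mem_def, Option.some.injEq] at hd
    subst hd
    exact h.not_mem_VT hsV
  have hlast : ∀ d ∈ l'.getLast?, d ∉ VT := fun d hd => by
    rw [hl.2.2.2.1] at hd
    simp only [Option.mem_def, Option.some.injEq] at hd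
    subst hd
    exact h.not_mem_VT htV
  obtain ⟨u, xs, v, hs, -⟩ :=
    exists_isSeg_of_mem (hl.mem_iff.2 (Finset.mem_union_right _ h.a_mem)) h.a_mem hhead hlast
  exact ⟨u, xs, v, hs⟩

/-- **Decomposition of a Hamiltonian path of `G'`** around its unique gadget traversal:
`l' = l₁ ++ u :: (xs ++ v :: l₂)` with `u ≠ v` ports, `xs` a Hamiltonian path of `G'` through
`VT` from `nb u` to `nb v`, and `l₁`, `l₂` inside `V`. [cite: GareyJohnson1979, §3.2.2] -/
theorem decomp (hsV : s ∈ V) (htV : t ∈ V) (hl : IsHamPathOn G' (V ∪ VT) s t l') :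
    ∃ l₁ l₂ u v xs, l' = l₁ ++ u :: (xs ++ v :: l₂) ∧ h.IsPort u ∧ h.IsPort v ∧ u ≠ v ∧
      IsHamPathOn G' VT (h.nb u) (h.nb v) xs ∧ (∀ d ∈ l₁, d ∈ V) ∧ (∀ d ∈ l₂, d ∈ V) := by
  obtain ⟨u, xs, v, hs⟩ := h.exists_seg hsV htV hl
  obtain ⟨⟨l₁, l₂, hl'⟩, -, hxs, -, -⟩ := id hs
  obtain ⟨hpu, hpv, -, -⟩ := h.ports_of_isSeg hl hs
  have hinV : ∀ d ∈ l', d ∉ xs → d ∈ V := fun d hd hdx => by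
    rcases Finset.mem_union.1 (hl.mem_iff.1 hd) with hdV | hdT
    · exact hdV
    · exact absurd (h.seg_covers hsV htV hl hs d hdT) hdx
  have hnd : l'.Nodup := hl.1
  rw [hl'] at hnd
  refine ⟨l₁, l₂, u, v, xs, hl', hpu, hpv, ne_of_isSeg hl hs, h.isHamPathOn_of_isSeg hsV htV hl hs,
    fun d hd => hinV d (by rw [hl']; simp [hd]) fun hdx => ?_,
    fun d hd => hinV d (by rw [hl']; simp [hd]) fun hdx => ?_⟩
  · exact (List.disjoint_of_nodup_append hnd) hd (by simp [hdx])
  · have hnd' := (List.nodup_append'.1 hnd).2.1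
    rw [List.nodup_cons] at hnd'
    have hnd'' := hnd'.2
    exact (List.disjoint_of_nodup_append hnd'') hdx (by simp [hd])

end PortGadget

end Literature.Combinatorics.SimpleGraph
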